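import Summits.RiemannHypothesis.RiemannHypothesis.Theorems.PfPersistenceGalerkinFormDomain
import Summits.RiemannHypothesis.RiemannHypothesis.Theorems.PfPersistenceGalerkinDownCone
import Summits.RiemannHypothesis.RiemannHypothesis.Theorems.PfPersistencePolarRankOne
import Summits.RiemannHypothesis.RiemannHypothesis.Theorems.PfPersistenceCollarBound
import Summits.RiemannHypothesis.RiemannHypothesis.Theorems.WeilWindowFlowWindowLipschitzStubFormDomainPos
import HarnessLib

/-!
# The cut-off Galerkin profile: `L²` data, shifted products, increments, and the prime block

`mechanism/rigidity campaign; no RH claims`.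

For a window `win = (a, N)` and a coefficient vector `v`, the cut-off profile
`f = cutoffProfile win v = 𝟙_{[-a,a]} · Σ vₙ ξₙ` (even, real, in `L²`, **not smooth**;
`PfPersistenceGalerkinFormDomain`) satisfies (all PROVED here, RH-free):

* `∫ ‖f‖² = v ⬝ᵥ v` (orthonormality of `ξₙ` on `[-a, a]`), `MemLp f 2`;
* `∫ f(x+t) f(x) dx = A(t) := autocorr (2a) v t` for `0 ≤ t ≤ 2a` and `= 0` for `t > 2a`, hence the
  increments `D_t(f) = weilIncrement f t` are `2(v ⬝ᵥ v) − 2A(t)` on `[0, 2a]` and `2(v ⬝ᵥ v)` beyond;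
* the PRIME IDENTITY `−v ⬝ᵥ (primesBlock Λq^{-1/2} win · v) = Σ_{log n < 2a} Λ(n)/√n · D_{log n}(f)
  − 2(Σ Λ(n)/√n)(v ⬝ᵥ v)` (the prime part of the Markov closed form of `WeilMarkovQuadratic`);
* a calculus lemma used by the archimedean block (`PfPersistenceGalerkinCutoffArch`): `h(y)/sinh y` is
  integrable on `(0, L]` for `C¹` `h` with `h(0) = 0`, and the pattern functions / autocorrelation are `C¹`.

Continued in `PfPersistenceGalerkinCutoffArch` (archimedean block) and
`PfPersistenceGalerkinClosedFormIdentity` (polar block, the closed-form identity, GAL‑0 with the full bottom).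
-/

set_option linter.dupNamespace false

noncomputable section

open Real intervalIntegral MeasureTheory Set Matrix Filter
open scoped Topology

namespace Summit.RiemannHypothesis.RiemannHypothesis.Theorems.PfPersistence

open Literature.NumberTheory.LFunctions

/-! ## 1. A calculus lemma: `h(y)/sinh y` is integrable near `0` for `C¹` `h` with `h 0 = 0` -/

/-- A `C¹` function vanishing at `0` is `O(y)` on `[0, L]`: `|h y| ≤ C y` (mean value inequality). [folklore] -/
theorem exists_abs_le_mul_of_contDiff {h : ℝ → ℝ} (hh : ContDiff ℝ 1 h) (h0 : h 0 = 0)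
    (L : ℝ) : ∃ C, 0 ≤ C ∧ ∀ y ∈ Icc 0 L, |h y| ≤ C * y := by
  obtain ⟨C, hC⟩ := isCompact_Icc.exists_bound_of_continuousOn
    ((hh.continuous_deriv le_rfl).continuousOn (s := Icc 0 L))
  refine ⟨|C|, abs_nonneg C, fun y hy => ?_⟩
  have hdiff : ∀ x ∈ Icc 0 L, DifferentiableAt ℝ h x := fun x _ =>
    (hh.differentiable one_ne_zero).differentiableAt
  have hC' : ∀ x ∈ Icc 0 L, ‖deriv h x‖ ≤ |C| := fun x hx => (hC x hx).trans (le_abs_self C)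
  have key := (convex_Icc 0 L).norm_image_sub_le_of_norm_deriv_le hdiff hC'
    (left_mem_Icc.2 (hy.1.trans hy.2)) hy
  simpa [h0, Real.norm_eq_abs, abs_of_nonneg hy.1] using key

/-- `h(y)/sinh y` is integrable on `(0, L]` for `C¹` `h` with `h 0 = 0` (bounded by `C y / sinh y ≤ C`). [folklore] -/
theorem integrableOn_div_sinh_Ioc {h : ℝ → ℝ} (hh : ContDiff ℝ 1 h) (h0 : h 0 = 0) (L : ℝ) :
    IntegrableOn (fun y => h y / Real.sinh y) (Ioc 0 L) := by
  obtain ⟨C, hC0, hC⟩ := exists_abs_le_mul_of_contDiff hh h0 L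
  refine Measure.integrableOn_of_bounded (M := C) measure_Ioc_lt_top.ne
    ((hh.continuous.measurable.div Real.continuous_sinh.measurable).aestronglyMeasurable) ?_
  refine (ae_restrict_iff' measurableSet_Ioc).2 (Eventually.of_forall fun y hy => ?_)
  have hy0 : 0 < y := hy.1
  have hs : 0 < Real.sinh y := Real.sinh_pos_iff.2 hy0
  have hys : y ≤ Real.sinh y := Real.self_le_sinh_iff.2 hy0.le
  rw [Real.norm_eq_abs, abs_div, abs_of_pos hs, div_le_iff₀ hs]
  exact (hC y ⟨hy0.le, hy.2⟩).trans (mul_le_mul_of_nonneg_left hys hC0)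

/-- Interval-integrable version of `integrableOn_div_sinh_Ioc`. [folklore] -/
theorem intervalIntegrable_div_sinh {h : ℝ → ℝ} (hh : ContDiff ℝ 1 h) (h0 : h 0 = 0) {L : ℝ}
    (hL : 0 ≤ L) : IntervalIntegrable (fun y => h y / Real.sinh y) volume 0 L := by
  rw [intervalIntegrable_iff_integrableOn_Ioc_of_le hL]
  exact integrableOn_div_sinh_Ioc hh h0 L

/-! ## 2. Smoothness of the pattern functions and of the autocorrelation -/

/-- The pattern functions `θₙₘ(L; ·)` are `C¹` (trigonometric polynomials times affine functions). [folklore] -/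
theorem contDiff_thetaEven (L : ℝ) (n m : ℕ) : ContDiff ℝ 1 (thetaEven L n m) := by
  by_cases hn : n = 0
  · by_cases hm : m = 0
    · have : thetaEven L n m = fun y => (L - y) / L := by
        funext y; simp [thetaEven, hn, hm]
      rw [this]; fun_prop
    · have : thetaEven L n m = fun y => -Real.sin (2 * π * m * y / L) / (Real.sqrt 2 * π * m) := by
        funext y; simp [thetaEven, hn, hm]
      rw [this]; fun_prop
  · by_cases hm : m = 0
    · have : thetaEven L n m = fun y => -Real.sin (2 * π * n * y / L) / (Real.sqrt 2 * π * n) := by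
        funext y; simp [thetaEven, hn, hm]
      rw [this]; fun_prop
    · by_cases hnm : n = m
      · have : thetaEven L n m = fun y =>
            (L - y) / L * Real.cos (2 * π * n * y / L) - Real.sin (2 * π * n * y / L) / (2 * π * n) := by
          funext y; simp [thetaEven, hm, hnm]
        rw [this]; fun_prop
      · have : thetaEven L n m = fun y =>
            (n * Real.sin (2 * π * n * y / L) - m * Real.sin (2 * π * m * y / L)) /
              (π * ((m : ℝ) ^ 2 - (n : ℝ) ^ 2)) := by
          funext y; simp [thetaEven, hn, hm, hnm]
        rw [this]; fun_prop

/-- The autocorrelation of the profile as a finite sum of pattern functions is `C¹`. -/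
theorem contDiff_sum_thetaEven {N : ℕ} (L : ℝ) (v : Fin (N + 1) → ℝ) :
    ContDiff ℝ 1 (fun y => ∑ n : Fin (N + 1), ∑ m : Fin (N + 1),
      v n * thetaEven L n m y * v m) := by
  refine ContDiff.sum fun n _ => ContDiff.sum fun m _ => ?_
  exact (contDiff_const.mul (contDiff_thetaEven L n m)).mul contDiff_const

/-- The windowed autocorrelation as the double sum `Σₙₘ vₙ θₙₘ vₘ` (as a function). [folklore] -/
theorem autocorr_eq_sum {N : ℕ} {L : ℝ} (hL : 0 < L) (v : Fin (N + 1) → ℝ) :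
    autocorr L v = fun y => ∑ n : Fin (N + 1), ∑ m : Fin (N + 1),
      v n * thetaEven L n m y * v m := by
  funext y; exact (sum_thetaEven_eq_autocorr hL v y).symm

/-- The windowed autocorrelation is `C¹`. [folklore] -/
theorem contDiff_autocorr {N : ℕ} {L : ℝ} (hL : 0 < L) (v : Fin (N + 1) → ℝ) :
    ContDiff ℝ 1 (autocorr L v) := by
  rw [autocorr_eq_sum hL v]; exact contDiff_sum_thetaEven L v

/-- `autocorr L v L = 0`: at the full shift the overlap interval is a point. -/
theorem autocorr_self {N : ℕ} (L : ℝ) (v : Fin (N + 1) → ℝ) : autocorr L v L = 0 := by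
  unfold autocorr
  rw [show L / 2 - L = -(L / 2) by ring, intervalIntegral.integral_same]

/-! ## 3. The cut-off profile: square norm, shifted products, increments -/

section Cutoff

variable (win : Window) (v : Fin (win.N + 1) → ℝ)

/-- Unfolding lemma for the cut-off profile. [folklore] -/
theorem cutoffProfile_apply (t : ℝ) :
    cutoffProfile win v t =
      (((Icc (-win.a) win.a).indicator (profile (2 * win.a) v) t : ℝ) : ℂ) := rfl

/-- The cut-off profile vanishes off `[-a, a]`. [folklore] -/
theorem cutoffProfile_eq_zero_of_not_mem {x : ℝ} (hx : x ∉ Icc (-win.a) win.a) :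
    cutoffProfile win v x = 0 := by
  rw [cutoffProfile_apply, indicator_of_notMem hx, Complex.ofReal_zero]

/-- The cut-off profile is measurable. [folklore] -/
theorem measurable_cutoffProfile : Measurable (cutoffProfile win v) :=
  Complex.measurable_ofReal.comp
    ((CentralMassFloor.continuous_profile _ _).measurable.indicator measurableSet_Icc)

/-- `‖f t‖² = (𝟙_{[-a,a]} θ)(t)²` for the cut-off profile `f`. [folklore] -/
theorem norm_sq_cutoffProfile (t : ℝ) :
    ‖cutoffProfile win v t‖ ^ 2 = ((Icc (-win.a) win.a).indicator (profile (2 * win.a) v) t) ^ 2 := by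
  rw [cutoffProfile_apply, Complex.norm_real, Real.norm_eq_abs, sq_abs]

/-- The square of the indicator-profile is the indicator of the squared profile. [folklore] -/
theorem indicator_profile_sq (t : ℝ) :
    ((Icc (-win.a) win.a).indicator (profile (2 * win.a) v) t) ^ 2 =
      (Icc (-win.a) win.a).indicator (fun x => profile (2 * win.a) v x ^ 2) t := by
  by_cases ht : t ∈ Icc (-win.a) win.a
  · rw [indicator_of_mem ht, indicator_of_mem ht]
  · rw [indicator_of_notMem ht, indicator_of_notMem ht]; ring

/-- The squared indicator-profile is integrable. [folklore] -/
theorem integrable_indicator_profile_sq :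
    Integrable (fun t => ((Icc (-win.a) win.a).indicator (profile (2 * win.a) v) t) ^ 2) := by
  simp_rw [indicator_profile_sq]
  exact (integrable_indicator_iff measurableSet_Icc).2
    (((CentralMassFloor.continuous_profile _ _).pow 2).integrableOn_Icc)

/-- Orthonormality: `∫ (𝟙 θ)² = v ⬝ᵥ v`. -/
theorem integral_indicator_profile_sq :
    ∫ t, ((Icc (-win.a) win.a).indicator (profile (2 * win.a) v) t) ^ 2 = v ⬝ᵥ v := by
  have ha := win.ha
  simp_rw [indicator_profile_sq]
  rw [MeasureTheory.integral_indicator measurableSet_Icc, integral_Icc_eq_integral_Ioc,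
    ← intervalIntegral.integral_of_le (by linarith : -win.a ≤ win.a),
    ← autocorr_zero (by linarith : 0 < 2 * win.a) v, autocorr_zero_eq_integral_sq,
    show (2 * win.a) / 2 = win.a by ring]

/-- `‖f‖²` is integrable for the cut-off profile `f`. [folklore] -/
theorem integrable_norm_sq_cutoffProfile :
    Integrable (fun t => ‖cutoffProfile win v t‖ ^ 2) := by
  simp_rw [norm_sq_cutoffProfile]; exact integrable_indicator_profile_sq win v

/-- Second conjunct of `GalerkinMatrixIdentity`: `∫ ‖f‖² = v ⬝ᵥ v`. -/
theorem integral_norm_sq_cutoffProfile :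
    ∫ t, ‖cutoffProfile win v t‖ ^ 2 = v ⬝ᵥ v := by
  simp_rw [norm_sq_cutoffProfile]; exact integral_indicator_profile_sq win v

/-- The cut-off profile is in `L²`. [folklore] -/
theorem memLp_cutoffProfile : MemLp (cutoffProfile win v) 2 volume :=
  (memLp_two_iff_integrable_sq_norm (measurable_cutoffProfile win v).aestronglyMeasurable).2
    (integrable_norm_sq_cutoffProfile win v)

/-- Shifted product of the cut-off profile (`t ≥ 0`). -/
theorem indicator_profile_mul_shift {t : ℝ} (ht : 0 ≤ t) (x : ℝ) :
    (Icc (-win.a) win.a).indicator (profile (2 * win.a) v) (x + t) *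
        (Icc (-win.a) win.a).indicator (profile (2 * win.a) v) x =
      (Icc (-win.a) (win.a - t)).indicator
        (fun x => profile (2 * win.a) v x * profile (2 * win.a) v (x + t)) x := by
  by_cases hx : x ∈ Icc (-win.a) (win.a - t)
  · have h1 : x ∈ Icc (-win.a) win.a := ⟨hx.1, by linarith [hx.2]⟩
    have h2 : x + t ∈ Icc (-win.a) win.a := ⟨by linarith [hx.1], by linarith [hx.2]⟩
    rw [indicator_of_mem h2, indicator_of_mem h1, indicator_of_mem hx, mul_comm]
  · rw [indicator_of_notMem hx]
    simp only [mem_Icc, not_and_or, not_le] at hx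
    rcases hx with h | h
    · rw [indicator_of_notMem (s := Icc (-win.a) win.a) (a := x)
        (fun hm => absurd hm.1 (not_le.2 h)), mul_zero]
    · rw [indicator_of_notMem (s := Icc (-win.a) win.a) (a := x + t)
        (fun hm => absurd hm.2 (not_le.2 (by linarith))), zero_mul]

/-- The shifted product `F(x+t) F(x)` of the indicator-profile is integrable. [folklore] -/
theorem integrable_indicator_profile_mul_shift {t : ℝ} (ht : 0 ≤ t) :
    Integrable (fun x => (Icc (-win.a) win.a).indicator (profile (2 * win.a) v) (x + t) *
        (Icc (-win.a) win.a).indicator (profile (2 * win.a) v) x) := by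
  simp_rw [indicator_profile_mul_shift win v ht]
  refine (integrable_indicator_iff measurableSet_Icc).2 (Continuous.integrableOn_Icc ?_)
  exact (CentralMassFloor.continuous_profile _ _).mul
    ((CentralMassFloor.continuous_profile _ _).comp (continuous_id.add continuous_const))

/-- For `0 ≤ t ≤ 2a`: `∫ F(x+t) F(x) dx = A(t)`, the windowed autocorrelation. [folklore] -/
theorem integral_indicator_profile_mul_shift {t : ℝ} (ht0 : 0 ≤ t) (ht : t ≤ 2 * win.a) :
    ∫ x, (Icc (-win.a) win.a).indicator (profile (2 * win.a) v) (x + t) *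
        (Icc (-win.a) win.a).indicator (profile (2 * win.a) v) x = autocorr (2 * win.a) v t := by
  simp_rw [indicator_profile_mul_shift win v ht0]
  rw [MeasureTheory.integral_indicator measurableSet_Icc, integral_Icc_eq_integral_Ioc,
    ← intervalIntegral.integral_of_le (by linarith : -win.a ≤ win.a - t), autocorr,
    show -(2 * win.a / 2) = -win.a by ring, show 2 * win.a / 2 - t = win.a - t by ring]

/-- For `t > 2a` the shifted supports are disjoint: `∫ F(x+t) F(x) dx = 0`. [folklore] -/
theorem integral_indicator_profile_mul_shift_of_lt {t : ℝ} (ht : 2 * win.a < t) :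
    ∫ x, (Icc (-win.a) win.a).indicator (profile (2 * win.a) v) (x + t) *
        (Icc (-win.a) win.a).indicator (profile (2 * win.a) v) x = 0 := by
  have ha := win.ha
  simp_rw [indicator_profile_mul_shift win v (by linarith : 0 ≤ t)]
  rw [Set.Icc_eq_empty (by linarith : ¬ (-win.a ≤ win.a - t))]
  simp

/-- The increment of the cut-off profile at a shift `t ≥ 0`. -/
theorem weilIncrement_cutoffProfile {t : ℝ} (ht : 0 ≤ t) :
    weilIncrement (cutoffProfile win v) t =
      2 * (v ⬝ᵥ v) - 2 * ∫ x, (Icc (-win.a) win.a).indicator (profile (2 * win.a) v) (x + t) *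
        (Icc (-win.a) win.a).indicator (profile (2 * win.a) v) x := by
  set F := (Icc (-win.a) win.a).indicator (profile (2 * win.a) v) with hF
  have hsq : Integrable (fun x => F x ^ 2) := integrable_indicator_profile_sq win v
  have hsqt : Integrable (fun x => F (x + t) ^ 2) := hsq.comp_add_right t
  have hprod : Integrable (fun x => F (x + t) * F x) :=
    integrable_indicator_profile_mul_shift win v ht
  have e : ∀ x, ‖cutoffProfile win v (x + t) - cutoffProfile win v x‖ ^ 2 =
      F (x + t) ^ 2 + F x ^ 2 - 2 * (F (x + t) * F x) := by
    intro x
    rw [cutoffProfile_apply, cutoffProfile_apply, ← Complex.ofReal_sub, Complex.norm_real,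
      Real.norm_eq_abs, sq_abs]
    ring
  have hadd : Integrable (fun x => F (x + t) ^ 2 + F x ^ 2) := hsqt.add hsq
  have h2 : Integrable (fun x => 2 * (F (x + t) * F x)) := hprod.const_mul 2
  unfold weilIncrement
  simp_rw [e]
  rw [integral_sub hadd h2, integral_add hsqt hsq,
    MeasureTheory.integral_const_mul, integral_add_right_eq_self (fun x => F x ^ 2) t,
    integral_indicator_profile_sq]
  ring

/-- For `0 ≤ t ≤ 2a`: `D_t(f) = 2ν − 2A(t)` (`ν = v ⬝ᵥ v`). [folklore] -/
theorem weilIncrement_cutoffProfile_of_le {t : ℝ} (ht0 : 0 ≤ t) (ht : t ≤ 2 * win.a) :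
    weilIncrement (cutoffProfile win v) t = 2 * (v ⬝ᵥ v) - 2 * autocorr (2 * win.a) v t := by
  rw [weilIncrement_cutoffProfile win v ht0, integral_indicator_profile_mul_shift win v ht0 ht]

/-- For `t ≥ 2a`: `D_t(f) = 2ν`. [folklore] -/
theorem weilIncrement_cutoffProfile_of_ge {t : ℝ} (ht : 2 * win.a ≤ t) :
    weilIncrement (cutoffProfile win v) t = 2 * (v ⬝ᵥ v) := by
  have ha := win.ha
  rcases ht.eq_or_lt with h | h
  · rw [← h, weilIncrement_cutoffProfile_of_le win v (by linarith) le_rfl, autocorr_self]; ring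
  · rw [weilIncrement_cutoffProfile win v (by linarith),
      integral_indicator_profile_mul_shift_of_lt win v h]; ring

end Cutoff

/-! ## 6. The prime block -/

section Primes

variable (win : Window) (v : Fin (win.N + 1) → ℝ)

/-- `Λ(q) q^{-1/2} = Λ(q)/√q`. -/
theorem zetaWeights_eq_div_sqrt (q : ℕ) :
    zetaWeights q = (ArithmeticFunction.vonMangoldt q : ℝ) / Real.sqrt q := by
  unfold zetaWeights
  rw [div_eq_mul_inv (ArithmeticFunction.vonMangoldt q : ℝ), Real.sqrt_eq_rpow,
    Real.rpow_neg (Nat.cast_nonneg q)]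

/-- The prime sum of the `ζ`-block over `primeRange (2a)` is the sum over `weilPrimeIndex a`
(the two index sets differ only in `q` with `log q = 2a`, where the autocorrelation vanishes). -/
theorem sum_primeRange_eq_sum_weilPrimeIndex :
    ∑ q ∈ primeRange (2 * win.a), zetaWeights q * autocorr (2 * win.a) v (Real.log q) =
      ∑ n ∈ weilPrimeIndex win.a, (ArithmeticFunction.vonMangoldt n : ℝ) / Real.sqrt n *
        autocorr (2 * win.a) v (Real.log n) := by
  have hL : 0 ≤ 2 * win.a := by linarith [win.ha]
  rw [show weilPrimeIndex win.a = (primeRange (2 * win.a)).filter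
      (fun n : ℕ => Real.log n < 2 * win.a) from rfl, Finset.sum_filter]
  refine Finset.sum_congr rfl fun q hq => ?_
  split_ifs with h
  · rw [zetaWeights_eq_div_sqrt]
  · have hq' : Real.log q = 2 * win.a := le_antisymm (log_le_of_mem_primeRange hL hq) (not_lt.1 h)
    rw [hq', autocorr_self, mul_zero]

/-- THE PRIME IDENTITY: `−v ⬝ᵥ (primesBlock Λq^{-1/2} win · v)` equals the prime part of the closed
form, `Σ_{log n < 2a} Λ(n)/√n · D_{log n}(f) − 2 (Σ Λ(n)/√n) ν`. -/
theorem primesBlock_form_eq_energy :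
    -(v ⬝ᵥ (primesBlock zetaWeights win *ᵥ v)) =
      (∑ n ∈ weilPrimeIndex win.a, (ArithmeticFunction.vonMangoldt n : ℝ) / Real.sqrt n *
          weilIncrement (cutoffProfile win v) (Real.log n)) -
        2 * (∑ n ∈ weilPrimeIndex win.a, (ArithmeticFunction.vonMangoldt n : ℝ) / Real.sqrt n) *
          (v ⬝ᵥ v) := by
  have ha := win.ha
  rw [primesBlock_form_eq ha zetaWeights v, sum_primeRange_eq_sum_weilPrimeIndex, Finset.mul_sum,
    Finset.mul_sum, Finset.sum_mul, ← Finset.sum_sub_distrib, ← Finset.sum_neg_distrib]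
  refine Finset.sum_congr rfl fun n hn => ?_
  have hlt := mem_weilPrimeIndex.1 hn
  rw [weilIncrement_cutoffProfile_of_le win v (Real.log_natCast_nonneg n) hlt.le]
  ring

end Primes

end Summit.RiemannHypothesis.RiemannHypothesis.Theorems.PfPersistence
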